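import Summits.KontsevichZagierPeriods.KontsevichZagierPeriods.Theses.LowDimension
import Summits.KontsevichZagierPeriods.KontsevichZagierPeriods.Theorems.InverseLandauTateLiftingRealPeriodSwap

/-!
# `LowdimRealPeriodSwap` (stmt-KontsevichZagierPeriods-8773, route LowDimension) — proof

On the elliptic curve `y² = 4x³ − 28x + 24` (real roots `−3 < 1 < 2`) any two Kontsevich–Zagier
integral representations `[(2, ∞), (4x³ − 28x + 24)^(−1/2)]` and `[(−3, 1), (4x³ − 28x + 24)^(−1/2)]`
of the two real half-periods are KZ-equivalent: ONE change of variables (rule (2)) along the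
`2`-torsion translation `Φ(x) = (x − 5)/(x − 1)`. This is verbatim
`InverseLandau.tateLifting_realPeriodSwap` (line `Sketch` of the crux `TateLifting`,
stmt-KontsevichZagierPeriods-9129, lead c10), which this file re-exports under the route's name.
-/

namespace Summit.KontsevichZagierPeriods.LowDimension

/-- **`LowdimRealPeriodSwap`** (route LowDimension, stmt-KontsevichZagierPeriods-8773): the two real
half-period representations of `y² = 4x³ − 28x + 24` over `(2, ∞)` and `(−3, 1)` are KZ-equivalent
(one change of variables, `x ↦ (x − 5)/(x − 1)`). Proof: `InverseLandau.tateLifting_realPeriodSwap`.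
[cite: KontsevichZagier2001, §1.2] -/
theorem lowdimRealPeriodSwap_proof :
    Summit.KontsevichZagierPeriods.KontsevichZagierPeriods.Theses.LowDimension.LowdimRealPeriodSwap :=
  Summit.KontsevichZagierPeriods.InverseLandau.tateLifting_realPeriodSwap

end Summit.KontsevichZagierPeriods.LowDimension
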